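import Summits.PneNP.PneNP.Theorems.ChebyshevTracialDesignExactDimThree
import HarnessLib

/-!
# Cell pnp-psdrank, route `ChebyshevTracialDesign`: ANY THREE ODD CUTS SHARE A TIGHT PERFECT MATCHING, and the
# non-adjacent planarity step of the exact `r = 3` analysis (crux `TracialDecayExp20`, stmt-PneNP-19878)

Brick 78 (prover g14; MEMO-16 §6(b)(ii)/§6(d)). The propagation lemma of the ROBUST `r = 3` programme: in the dense cell adjacency of active cuts
is generically vacuous (MEMO-16 §6(a)), so the planarity step of brick 76 (which used, for an EVEN set `W` under two ADJACENT cuts, a matching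
splitting along `W` and tight with a prescribed third cut — brick 75 `exists_split_tight_cut`) has to be re-based on an ARBITRARY pair of cuts.
The combinatorial supply is:

* §1–§2 **`exists_three_tight`** (generic vertex type) / **`exists_three_tight_cut`** (`K_n` currency) — for EVERY three odd subsets
  `U₁, U₂, U₃` of an even vertex set `Ω` there is a perfect matching `M` of `Ω` with `cc(U₁,M) = cc(U₂,M) = cc(U₃,M) = 1` (no size or position
  conditions). Proof: induction on `|Ω|` removing a pair of vertices with the same membership pattern (the new edge crosses nothing); when the
  pattern map `Ω → {0,1}³` is injective, `|Uᵢ|, |Ω ∖ Uᵢ| ∈ {1, 3}`; a (co)singleton cut is tight for every perfect matching, so unless all three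
  cuts have `|Uᵢ| = |Ω ∖ Uᵢ| = 3` the two-cut lemma `exists_tight_tight` (brick 75 + the `±1` law) finishes; in the remaining case `|Ω| = 6` and
  injectivity yields two vertices `v ∈ Uᵢ`, `w ∉ Uᵢ` with the same membership in the other two cuts (the image of `Ω` cannot avoid all three
  cube-neighbours of a pattern), and `M = {vw} ∪ {Uᵢ − v} ∪ {(Ω ∖ Uᵢ) − w}` is tight with `Uᵢ` by construction and with `Uⱼ`, `j ≠ i`, by
  PARITY (`odd_crossCount`: `cc(Uⱼ,M)` is odd, and here `≤ 2`). (MEMO-16 §6(d) gives the same statement via the eight Venn cells; WARNING recorded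
  there: the analogous prescribed-crossing problem with a ZERO target has genuine obstructions, so the induction never passes through even cuts.)
* §3 **`parallel_of_common_tight`**, **`planar_of_independent_pair`** — the NON-ADJACENT planarity step, exact form: for unit labels `u` on the
  `t`-cuts and `v` on the matchings, orthogonal on every tight pair, a matching tight with two `t`-cuts `U₁, U₂` of non-parallel labels is labelled
  `∥ p = u_{U₁} × u_{U₂}`, hence EVERY `t`-cut label is orthogonal to `p` (a common tight matching of `U, U₁, U₂` exists by §2). In the robust
  programme (MEMO-16 §6(b)) the inputs 'the common tight matching is ACTIVE' are the pair-SNT statements; this file is the combinatorial half only.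
[cite: Rothvoss2017, §2 (PDF pp. 5–6: `δ(U)`, `|δ(U) ∩ M|`, the tight pairs `Q_1`)]
Stature: support/instrument (elementary combinatorics + the `ℝ³` algebra of brick 76). WHAT THIS IS NOT: no pair-SNT, no value bound for the
dense cell, nothing on psd rank of P_PM(K_n), no P-vs-NP content.
-/

set_option linter.dupNamespace false -- `Summit.PneNP.PneNP.…`: summit = sub-problem (D-0017)

noncomputable section

namespace Summit.PneNP.PneNP.Theorems.ChebyshevTracialDesignThreeWiseTightMatching

open Finset Matrix Literature.Barriers.PneNP Literature.Combinatorics.Optimization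
open Literature.Combinatorics.SimpleGraph.CycleSpace
open Literature.Combinatorics.AssociationSchemes.CutMatchingRestriction
open Summit.PneNP.PneNP.Theorems.ChebyshevTracialDesignTightLinks
open Summit.PneNP.PneNP.Theorems.ChebyshevTracialDesignCommonTightCut
open Summit.PneNP.PneNP.Theorems.ChebyshevTracialDesignSplittingMatchings
open Summit.PneNP.PneNP.Theorems.ChebyshevTracialDesignExactDimThree
open scoped Matrix

/-! ### §1 Generic vertex type -/

section Generic

variable {α : Type*} [DecidableEq α]

/-- **Parity.** An odd subset of the vertex set is crossed an odd number of times by every perfect matching.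
[cite: Rothvoss2017, §2 (PDF p. 6: "for parity reasons")] -/
theorem odd_crossCount {Ω U : Finset α} {M : Finset (Sym2 α)} (hM : IsPMOn Ω M) (hU : U ⊆ Ω) (hodd : Odd U.card) :
    Odd (crossCount U M) := by
  have h1 := hM.card_eq_sum_cutCount hU
  rw [sum_cutCount_eq] at h1
  have h2 : (M.filter fun e => cutCount U e = 1) = M.filter (Crosses U) := filter_congr fun e _ => cutCount_eq_one_iff
  rw [h2] at h1
  unfold crossCount
  obtain ⟨k, hk⟩ := hodd
  exact ⟨k - (M.filter fun e => cutCount U e = 2).card, by omega⟩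

/-- The crossing count of a single pair. -/
theorem crossCount_singleton_pair (U : Finset α) (e : Sym2 α) : crossCount U {e} = if Crosses U e then 1 else 0 := by
  unfold crossCount
  rw [filter_singleton]
  split_ifs <;> simp

/-- A pair inside `Ω` crosses `Ω ∖ U` iff it crosses `U`. [cite: Rothvoss2017, §2 (PDF p. 5: `δ(U) = δ(V ∖ U)`)] -/
theorem crosses_sdiff_iff {Ω U : Finset α} {e : Sym2 α} (he : e ∈ Ω.sym2) : Crosses (Ω \ U) e ↔ Crosses U e := by
  induction e using Sym2.ind with
  | h x y =>
    rw [mk_mem_sym2_iff] at he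
    simp only [crosses_mk, mem_sdiff, he.1, he.2, true_and, not_not]
    tauto

/-- Complement invariance: `cc(Ω ∖ U, M) = cc(U, M)` for edge sets inside `Ω`. [cite: Rothvoss2017, §2 (PDF p. 5)] -/
theorem crossCount_sdiff {Ω U : Finset α} {M : Finset (Sym2 α)} (hM : M ⊆ Ω.sym2) : crossCount (Ω \ U) M = crossCount U M := by
  unfold crossCount
  exact congrArg card (filter_congr fun e he => crosses_sdiff_iff (hM he))

/-- A singleton cut is tight for every perfect matching. -/
theorem crossCount_eq_one_of_card_eq_one {Ω U : Finset α} {M : Finset (Sym2 α)} (hM : IsPMOn Ω M) (hU : U ⊆ Ω) (h1 : U.card = 1) :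
    crossCount U M = 1 := by
  obtain ⟨a, rfl⟩ := card_eq_one.1 h1
  exact crossCount_singleton hM (hU (mem_singleton_self a))

/-- A co-singleton cut is tight for every perfect matching. -/
theorem crossCount_eq_one_of_card_sdiff_eq_one {Ω U : Finset α} {M : Finset (Sym2 α)} (hM : IsPMOn Ω M) (h1 : (Ω \ U).card = 1) :
    crossCount U M = 1 := by
  rw [← crossCount_sdiff hM.subset_sym2]
  exact crossCount_eq_one_of_card_eq_one hM sdiff_subset h1

/-- **Two odd cuts share a tight matching** (brick 75's `exists_split_tight` with `W = U − a`, then the `±1` law).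
[cite: Rothvoss2017, §2 (PDF p. 6: the tight pairs `Q_1`)] -/
theorem exists_tight_tight {Ω U U' : Finset α} (hU : U ⊆ Ω) (hU' : U' ⊆ Ω) (hΩ : Even Ω.card) (hUo : Odd U.card)
    (hU'o : Odd U'.card) : ∃ M, IsPMOn Ω M ∧ crossCount U M = 1 ∧ crossCount U' M = 1 := by
  obtain ⟨a, ha⟩ : U.Nonempty := card_pos.1 hUo.pos
  have hWe : Even (U.erase a).card := by rw [card_erase_of_mem ha]; obtain ⟨k, hk⟩ := hUo; exact ⟨k, by omega⟩
  obtain ⟨M, hM, h0, h1⟩ := exists_split_tight ((erase_subset a U).trans hU) hU' hWe hΩ hU'o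
  refine ⟨M, hM, ?_, h1⟩
  have h := crossCount_insert_eq_one_of_zero hM (hU ha) (notMem_erase a U) h0
  rwa [insert_erase ha] at h

/-- Removing a pair `{a, b}` with the same membership in `U`: the edge `{a, b}` does not cross `U`, and a matching of `Ω ∖ {a, b}` sees only
`U ∖ {a, b}`. -/
theorem crossCount_pair_union {Ω U : Finset α} {a b : α} (hab : a ≠ b) (hU : a ∈ U ↔ b ∈ U) {M' : Finset (Sym2 α)}
    (hM' : IsPMOn (Ω \ {a, b}) M') : crossCount U ({s(a, b)} ∪ M') = crossCount (U \ {a, b}) M' := by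
  have hd : Disjoint ({a, b} : Finset α) (Ω \ {a, b}) := disjoint_sdiff
  rw [crossCount_union ((IsPMOn.pair hab).disjoint_of_disjoint hM' hd), crossCount_singleton_pair]
  have hnc : ¬ Crosses U s(a, b) := by rw [crosses_mk]; tauto
  rw [if_neg hnc, zero_add]
  apply crossCount_congr hM'.subset_sym2
  ext x
  simp only [mem_inter, mem_sdiff, mem_insert, mem_singleton]
  tauto

/-- Removing a pair with the same membership keeps an odd cut odd. -/
theorem odd_card_sdiff_pair {U : Finset α} {a b : α} (hab : a ≠ b) (hU : a ∈ U ↔ b ∈ U) (ho : Odd U.card) :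
    Odd (U \ {a, b}).card := by
  by_cases ha : a ∈ U
  · have hb : b ∈ U := hU.1 ha
    have hsub : ({a, b} : Finset α) ⊆ U := insert_subset ha (singleton_subset_iff.2 hb)
    rw [card_sdiff_of_subset hsub, card_pair hab]
    have h2 : 2 ≤ U.card := by rw [← card_pair hab]; exact card_le_card hsub
    obtain ⟨k, hk⟩ := ho
    exact ⟨k - 1, by omega⟩
  · have hb : b ∉ U := fun h => ha (hU.2 h)
    have h : U \ {a, b} = U := by
      apply sdiff_eq_self_of_disjoint
      rw [disjoint_insert_right, disjoint_singleton_right]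
      exact ⟨ha, hb⟩
    rw [h]; exact ho

/-- **Injective patterns are few.** If no two distinct elements of `A` have the same membership in both `B` and `C`, then `|A| ≤ 4`. -/
theorem card_le_four_of_patterns {A B C : Finset α}
    (h : ∀ a ∈ A, ∀ b ∈ A, a ≠ b → ¬ ((a ∈ B ↔ b ∈ B) ∧ (a ∈ C ↔ b ∈ C))) : A.card ≤ 4 := by
  let f : α → Bool × Bool := fun v => (decide (v ∈ B), decide (v ∈ C))
  have hinj : Set.InjOn f A := by
    intro a ha b hb hfab
    by_contra hne
    apply h a ha b hb hne
    simp only [f, Prod.mk.injEq, decide_eq_decide] at hfab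
    exact hfab
  calc A.card = (A.image f).card := (card_image_of_injOn hinj).symm
    _ ≤ (univ : Finset (Bool × Bool)).card := card_le_card (subset_univ _)
    _ = 4 := by simp

/-- `decide p = !decide q ↔ ¬(p ↔ q)`. -/
private theorem decide_eq_not_decide_iff (p q : Prop) [Decidable p] [Decidable q] :
    (decide p = !decide q) ↔ ¬ (p ↔ q) := by
  by_cases hp : p <;> by_cases hq : q <;> simp [hp, hq]

/-- The three cube-neighbours of a pattern miss `5` of the `8` patterns. -/
private theorem card_univ_sdiff_neighbours (b₁ b₂ b₃ : Bool) :
    ((univ : Finset (Bool × Bool × Bool)) \ {(!b₁, b₂, b₃), (b₁, !b₂, b₃), (b₁, b₂, !b₃)}).card = 5 := by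
  revert b₁ b₂ b₃; decide

/-- **A cube edge inside an injective `6`-set.** If `|Ω| = 6` and no two distinct vertices of `Ω` have the same membership pattern in
`(U₁, U₂, U₃)`, then some two vertices of `Ω` differ in their membership of exactly one of the three sets. -/
theorem exists_adjacent_of_patterns {Ω U₁ U₂ U₃ : Finset α} (hΩ : Ω.card = 6)
    (hinj : ∀ a ∈ Ω, ∀ b ∈ Ω, a ≠ b → ¬ ((a ∈ U₁ ↔ b ∈ U₁) ∧ (a ∈ U₂ ↔ b ∈ U₂) ∧ (a ∈ U₃ ↔ b ∈ U₃))) :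
    ∃ v ∈ Ω, ∃ w ∈ Ω,
      (¬ (v ∈ U₁ ↔ w ∈ U₁) ∧ (v ∈ U₂ ↔ w ∈ U₂) ∧ (v ∈ U₃ ↔ w ∈ U₃)) ∨
      ((v ∈ U₁ ↔ w ∈ U₁) ∧ ¬ (v ∈ U₂ ↔ w ∈ U₂) ∧ (v ∈ U₃ ↔ w ∈ U₃)) ∨
      ((v ∈ U₁ ↔ w ∈ U₁) ∧ (v ∈ U₂ ↔ w ∈ U₂) ∧ ¬ (v ∈ U₃ ↔ w ∈ U₃)) := by
  have hne : Ω.Nonempty := card_pos.1 (by omega)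
  obtain ⟨v, hv⟩ := hne
  by_contra hno
  let f : α → Bool × Bool × Bool := fun x => (decide (x ∈ U₁), decide (x ∈ U₂), decide (x ∈ U₃))
  have hfinj : Set.InjOn f Ω := by
    intro a ha b hb hfab
    by_contra hab
    apply hinj a ha b hb hab
    simp only [f, Prod.mk.injEq, decide_eq_decide] at hfab
    exact hfab
  have key : ∀ w ∈ Ω, f w ≠ (!decide (v ∈ U₁), decide (v ∈ U₂), decide (v ∈ U₃)) ∧
      f w ≠ (decide (v ∈ U₁), !decide (v ∈ U₂), decide (v ∈ U₃)) ∧ f w ≠ (decide (v ∈ U₁), decide (v ∈ U₂), !decide (v ∈ U₃)) := by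
    intro w hw
    refine ⟨fun heq => ?_, fun heq => ?_, fun heq => ?_⟩ <;>
      simp only [f, Prod.mk.injEq, decide_eq_decide, decide_eq_not_decide_iff] at heq
    · exact hno ⟨v, hv, w, hw, Or.inl ⟨fun h => heq.1 h.symm, heq.2.1.symm, heq.2.2.symm⟩⟩
    · exact hno ⟨v, hv, w, hw, Or.inr (Or.inl ⟨heq.1.symm, fun h => heq.2.1 h.symm, heq.2.2.symm⟩)⟩
    · exact hno ⟨v, hv, w, hw, Or.inr (Or.inr ⟨heq.1.symm, heq.2.1.symm, fun h => heq.2.2 h.symm⟩)⟩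
  have hsub : Ω.image f ⊆ (univ : Finset (Bool × Bool × Bool)) \
      {(!decide (v ∈ U₁), decide (v ∈ U₂), decide (v ∈ U₃)), (decide (v ∈ U₁), !decide (v ∈ U₂), decide (v ∈ U₃)),
        (decide (v ∈ U₁), decide (v ∈ U₂), !decide (v ∈ U₃))} := by
    intro y hy
    obtain ⟨w, hw, rfl⟩ := mem_image.1 hy
    obtain ⟨k1, k2, k3⟩ := key w hw
    simp only [mem_sdiff, mem_univ, true_and, mem_insert, mem_singleton, not_or]
    exact ⟨k1, k2, k3⟩
  have hcard := card_le_card hsub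
  rw [card_image_of_injOn hfinj, hΩ, card_univ_sdiff_neighbours] at hcard
  omega

/-- **The `|Ω| = 6` construction.** `Ω` of size `6`; `A ⊆ Ω` with `|A| = 3`; odd `B, C ⊆ Ω`; `v ∈ A`, `w ∈ Ω ∖ A` with the same membership in
`B` and in `C`. Then `M = {vw} ∪ {A − v} ∪ {(Ω ∖ A) − w}` is a perfect matching of `Ω` tight with `A` (only `vw` crosses `A`) and with `B` and `C`
(their crossing counts are odd and at most `2`). -/
theorem exists_three_tight_of_adjacent {Ω A B C : Finset α} (hA : A ⊆ Ω) (hB : B ⊆ Ω) (hC : C ⊆ Ω) (hΩ : Ω.card = 6)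
    (hAc : A.card = 3) (hBo : Odd B.card) (hCo : Odd C.card) {v w : α} (hv : v ∈ A) (hwΩ : w ∈ Ω) (hw : w ∉ A)
    (hvwB : v ∈ B ↔ w ∈ B) (hvwC : v ∈ C ↔ w ∈ C) :
    ∃ M, IsPMOn Ω M ∧ crossCount A M = 1 ∧ crossCount B M = 1 ∧ crossCount C M = 1 := by
  have hvw : v ≠ w := fun h => hw (h ▸ hv)
  -- `A − v = {a, b}` and `(Ω ∖ A) − w = {c, d}`
  have hA2 : (A.erase v).card = 2 := by rw [card_erase_of_mem hv, hAc]
  obtain ⟨a, b, hab, hAe⟩ := card_eq_two.1 hA2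
  have hwA' : w ∈ Ω \ A := mem_sdiff.2 ⟨hwΩ, hw⟩
  have hD2 : ((Ω \ A).erase w).card = 2 := by rw [card_erase_of_mem hwA', card_sdiff_of_subset hA, hΩ, hAc]
  obtain ⟨c, d, hcd, hDe⟩ := card_eq_two.1 hD2
  have haA : a ∈ A := mem_of_mem_erase (by rw [hAe]; exact mem_insert_self a {b})
  have hbA : b ∈ A := mem_of_mem_erase (by rw [hAe]; exact mem_insert_of_mem (mem_singleton_self b))
  have hcA : c ∉ A := (mem_sdiff.1 (mem_of_mem_erase (by rw [hDe]; exact mem_insert_self c {d}))).2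
  have hdA : d ∉ A := (mem_sdiff.1 (mem_of_mem_erase (by rw [hDe]; exact mem_insert_of_mem (mem_singleton_self d)))).2
  -- the three pairs
  have hM1 := IsPMOn.pair hvw; have hM2 := IsPMOn.pair hab; have hM3 := IsPMOn.pair hcd
  have hd23 : Disjoint ({a, b} : Finset α) {c, d} := by
    rw [← hAe, ← hDe]
    exact (disjoint_sdiff (s := A) (t := Ω)).mono (erase_subset _ _) (erase_subset _ _)
  have h23 := hM2.union hM3 hd23
  have hd1 : Disjoint ({v, w} : Finset α) ({a, b} ∪ {c, d}) := by
    rw [← hAe, ← hDe, disjoint_union_right, disjoint_insert_left, disjoint_singleton_left, disjoint_insert_left,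
      disjoint_singleton_left]
    exact ⟨⟨notMem_erase v A, fun h => hw (mem_of_mem_erase h)⟩,
      ⟨fun h => (mem_sdiff.1 (mem_of_mem_erase h)).2 hv, notMem_erase w _⟩⟩
  have hall := hM1.union h23 hd1
  have hset : ({v, w} : Finset α) ∪ ({a, b} ∪ {c, d}) = Ω := by
    rw [← hAe, ← hDe]
    ext x
    simp only [mem_union, mem_insert, mem_singleton, mem_erase, mem_sdiff]
    constructor
    · rintro ((rfl | rfl) | (⟨-, hx⟩ | ⟨-, hx, -⟩))
      exacts [hA hv, hwΩ, hA hx, hx]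
    · intro hx
      by_cases hxv : x = v
      · exact Or.inl (Or.inl hxv)
      by_cases hxw : x = w
      · exact Or.inl (Or.inr hxw)
      exact Or.inr ((em (x ∈ A)).imp (fun hxA => ⟨hxv, hxA⟩) fun hxA => ⟨hxw, hx, hxA⟩)
  rw [hset] at hall
  have hdisj1 : Disjoint ({s(v, w)} : Finset (Sym2 α)) ({s(a, b)} ∪ {s(c, d)}) := hM1.disjoint_of_disjoint h23 hd1
  have hdisj2 : Disjoint ({s(a, b)} : Finset (Sym2 α)) {s(c, d)} := hM2.disjoint_of_disjoint hM3 hd23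
  have hcc : ∀ U : Finset α, crossCount U ({s(v, w)} ∪ ({s(a, b)} ∪ {s(c, d)})) =
      (if Crosses U s(v, w) then 1 else 0) + ((if Crosses U s(a, b) then 1 else 0) + (if Crosses U s(c, d) then 1 else 0)) := by
    intro U
    rw [crossCount_union hdisj1, crossCount_union hdisj2, crossCount_singleton_pair, crossCount_singleton_pair,
      crossCount_singleton_pair]
  -- `B`, `C`: `vw` does not cross, and the count is odd and at most `2`
  have hpar : ∀ {D : Finset α}, D ⊆ Ω → Odd D.card → (v ∈ D ↔ w ∈ D) → crossCount D ({s(v, w)} ∪ ({s(a, b)} ∪ {s(c, d)})) = 1 := by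
    intro D hD hDo hvwD
    have hodd := odd_crossCount hall hD hDo
    rw [hcc, if_neg (by rw [crosses_mk]; tauto)] at hodd ⊢
    obtain ⟨k, hk⟩ := hodd
    split_ifs at hk ⊢ <;> omega
  refine ⟨{s(v, w)} ∪ ({s(a, b)} ∪ {s(c, d)}), hall, ?_, hpar hB hBo hvwB, hpar hC hCo hvwC⟩
  -- `A`: only `vw` crosses
  rw [hcc, if_pos ((crosses_mk A v w).2 (Or.inl ⟨hv, hw⟩)), if_neg (by rw [crosses_mk]; tauto),
    if_neg (by rw [crosses_mk]; tauto)]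

/-- **ANY THREE ODD CUTS SHARE A TIGHT PERFECT MATCHING.** For an even vertex set `Ω` and odd subsets `U₁, U₂, U₃ ⊆ Ω` there is a perfect
matching `M` of `Ω` with `cc(U₁, M) = cc(U₂, M) = cc(U₃, M) = 1`. [cite: Rothvoss2017, §2 (PDF p. 6: the tight pairs `Q_1`)] -/
theorem exists_three_tight {Ω U₁ U₂ U₃ : Finset α} (hΩ : Even Ω.card) (hU₁ : U₁ ⊆ Ω) (hU₂ : U₂ ⊆ Ω) (hU₃ : U₃ ⊆ Ω)
    (ho₁ : Odd U₁.card) (ho₂ : Odd U₂.card) (ho₃ : Odd U₃.card) :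
    ∃ M, IsPMOn Ω M ∧ crossCount U₁ M = 1 ∧ crossCount U₂ M = 1 ∧ crossCount U₃ M = 1 := by
  suffices h : ∀ (m : ℕ) (Ω U₁ U₂ U₃ : Finset α), Ω.card = m → Even Ω.card → U₁ ⊆ Ω → U₂ ⊆ Ω → U₃ ⊆ Ω →
      Odd U₁.card → Odd U₂.card → Odd U₃.card →
      ∃ M, IsPMOn Ω M ∧ crossCount U₁ M = 1 ∧ crossCount U₂ M = 1 ∧ crossCount U₃ M = 1 from
    h _ Ω U₁ U₂ U₃ rfl hΩ hU₁ hU₂ hU₃ ho₁ ho₂ ho₃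
  intro m
  induction m using Nat.strong_induction_on with
  | _ m ih =>
  intro Ω U₁ U₂ U₃ hm hΩ hU₁ hU₂ hU₃ ho₁ ho₂ ho₃
  by_cases hcell : ∃ a ∈ Ω, ∃ b ∈ Ω, a ≠ b ∧ (a ∈ U₁ ↔ b ∈ U₁) ∧ (a ∈ U₂ ↔ b ∈ U₂) ∧ (a ∈ U₃ ↔ b ∈ U₃)
  · -- (a) remove a pair of vertices with the same membership pattern
    obtain ⟨a, ha, b, hb, hab, h₁, h₂, h₃⟩ := hcell
    have hpair : ({a, b} : Finset α) ⊆ Ω := insert_subset ha (singleton_subset_iff.2 hb)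
    have hcard : (Ω \ {a, b}).card = Ω.card - 2 := by rw [card_sdiff_of_subset hpair, card_pair hab]
    have h2 : 2 ≤ Ω.card := by rw [← card_pair hab]; exact card_le_card hpair
    have hΩ' : Even (Ω \ {a, b}).card := by
      rw [hcard]; obtain ⟨k, hk⟩ := hΩ; exact ⟨k - 1, by omega⟩
    obtain ⟨M', hM', h₁', h₂', h₃'⟩ := ih (Ω \ {a, b}).card (by rw [hcard]; omega) (Ω \ {a, b}) (U₁ \ {a, b}) (U₂ \ {a, b})
      (U₃ \ {a, b}) rfl hΩ' (sdiff_subset_sdiff hU₁ Subset.rfl) (sdiff_subset_sdiff hU₂ Subset.rfl)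
      (sdiff_subset_sdiff hU₃ Subset.rfl) (odd_card_sdiff_pair hab h₁ ho₁) (odd_card_sdiff_pair hab h₂ ho₂)
      (odd_card_sdiff_pair hab h₃ ho₃)
    refine ⟨{s(a, b)} ∪ M', ?_, ?_, ?_, ?_⟩
    · have h := (IsPMOn.pair hab).union hM' disjoint_sdiff
      rwa [union_sdiff_of_subset hpair] at h
    · rw [crossCount_pair_union hab h₁ hM', h₁']
    · rw [crossCount_pair_union hab h₂ hM', h₂']
    · rw [crossCount_pair_union hab h₃ hM', h₃']
  · -- (b) the membership pattern is injective on `Ω`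
    have hinj : ∀ a ∈ Ω, ∀ b ∈ Ω, a ≠ b → ¬ ((a ∈ U₁ ↔ b ∈ U₁) ∧ (a ∈ U₂ ↔ b ∈ U₂) ∧ (a ∈ U₃ ↔ b ∈ U₃)) :=
      fun a ha b hb hab hpat => hcell ⟨a, ha, b, hb, hab, hpat⟩
    -- (co)singleton cuts are tight for every perfect matching
    have easy : ∀ {U : Finset α}, U ⊆ Ω → (U.card = 1 ∨ (Ω \ U).card = 1) → ∀ {M : Finset (Sym2 α)}, IsPMOn Ω M →
        crossCount U M = 1 :=
      fun hU h _ hM => h.elim (crossCount_eq_one_of_card_eq_one hM hU) (crossCount_eq_one_of_card_sdiff_eq_one hM)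
    by_cases e₁ : U₁.card = 1 ∨ (Ω \ U₁).card = 1
    · obtain ⟨M, hM, h₂, h₃⟩ := exists_tight_tight hU₂ hU₃ hΩ ho₂ ho₃
      exact ⟨M, hM, easy hU₁ e₁ hM, h₂, h₃⟩
    by_cases e₂ : U₂.card = 1 ∨ (Ω \ U₂).card = 1
    · obtain ⟨M, hM, h₁, h₃⟩ := exists_tight_tight hU₁ hU₃ hΩ ho₁ ho₃
      exact ⟨M, hM, h₁, easy hU₂ e₂ hM, h₃⟩
    by_cases e₃ : U₃.card = 1 ∨ (Ω \ U₃).card = 1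
    · obtain ⟨M, hM, h₁, h₂⟩ := exists_tight_tight hU₁ hU₂ hΩ ho₁ ho₂
      exact ⟨M, hM, h₁, h₂, easy hU₃ e₃ hM⟩
    rw [not_or] at e₁ e₂ e₃
    -- all three cuts are hard: `|Uᵢ| = 3`, `|Ω| = 6`
    have hb₁ : U₁.card ≤ 4 := card_le_four_of_patterns fun a ha b hb hab h =>
      hinj a (hU₁ ha) b (hU₁ hb) hab ⟨iff_of_true ha hb, h⟩
    have hb₂ : U₂.card ≤ 4 := card_le_four_of_patterns fun a ha b hb hab h =>
      hinj a (hU₂ ha) b (hU₂ hb) hab ⟨h.1, iff_of_true ha hb, h.2⟩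
    have hb₃ : U₃.card ≤ 4 := card_le_four_of_patterns fun a ha b hb hab h =>
      hinj a (hU₃ ha) b (hU₃ hb) hab ⟨h.1, h.2, iff_of_true ha hb⟩
    have hc₁ : (Ω \ U₁).card ≤ 4 := card_le_four_of_patterns fun a ha b hb hab h =>
      hinj a (mem_sdiff.1 ha).1 b (mem_sdiff.1 hb).1 hab ⟨iff_of_false (mem_sdiff.1 ha).2 (mem_sdiff.1 hb).2, h⟩
    have hsd₁ := card_sdiff_of_subset hU₁
    have hle₁ := card_le_card hU₁
    have hU₁3 : U₁.card = 3 := by obtain ⟨k, hk⟩ := ho₁; omega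
    have hU₂3 : U₂.card = 3 := by obtain ⟨k, hk⟩ := ho₂; omega
    have hU₃3 : U₃.card = 3 := by obtain ⟨k, hk⟩ := ho₃; omega
    have hΩ6 : Ω.card = 6 := by obtain ⟨k, hk⟩ := hΩ; omega
    obtain ⟨v, hv, w, hw, hadj⟩ := exists_adjacent_of_patterns hΩ6 hinj
    have orient : ∀ {A B C : Finset α}, A ⊆ Ω → B ⊆ Ω → C ⊆ Ω → A.card = 3 → Odd B.card → Odd C.card →
        ¬ (v ∈ A ↔ w ∈ A) → (v ∈ B ↔ w ∈ B) → (v ∈ C ↔ w ∈ C) →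
        ∃ M, IsPMOn Ω M ∧ crossCount A M = 1 ∧ crossCount B M = 1 ∧ crossCount C M = 1 := by
      intro A B C hA hB hC hA3 hBo hCo hvA hvB hvC
      by_cases hvA' : v ∈ A
      · exact exists_three_tight_of_adjacent hA hB hC hΩ6 hA3 hBo hCo hvA' hw (fun h => hvA (iff_of_true hvA' h)) hvB hvC
      · exact exists_three_tight_of_adjacent hA hB hC hΩ6 hA3 hBo hCo (by by_contra h; exact hvA (iff_of_false hvA' h)) hv hvA'
          hvB.symm hvC.symm
    rcases hadj with ⟨h1, h2, h3⟩ | ⟨h1, h2, h3⟩ | ⟨h1, h2, h3⟩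
    · exact orient hU₁ hU₂ hU₃ hU₁3 ho₂ ho₃ h1 h2 h3
    · obtain ⟨M, hM, k₂, k₁, k₃⟩ := orient hU₂ hU₁ hU₃ hU₂3 ho₁ ho₃ h2 h1 h3
      exact ⟨M, hM, k₁, k₂, k₃⟩
    · obtain ⟨M, hM, k₃, k₁, k₂⟩ := orient hU₃ hU₁ hU₂ hU₃3 ho₁ ho₂ h3 h1 h2
      exact ⟨M, hM, k₁, k₂, k₃⟩

end Generic

/-! ### §2 The kernel's currency -/

section Cuts

variable {n : ℕ}

/-- **Any three odd cuts of `K_n` (`n` even) share a tight perfect matching**: `T(U₁) ∩ T(U₂) ∩ T(U₃) ≠ ∅` for all `U₁, U₂, U₃ : OddSet n`, where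
`T(U) = {M : cc(U,M) = 1}`. The `3`-wise propagation lemma of the robust `r = 3` programme (MEMO-16 §6(b)(ii)).
[cite: Rothvoss2017, §2 (PDF p. 6: the tight pairs `Q_1`)] -/
theorem exists_three_tight_cut (hn : Even n) (U₁ U₂ U₃ : OddSet n) :
    ∃ M : PMatch n, cc U₁ M = 1 ∧ cc U₂ M = 1 ∧ cc U₃ M = 1 := by
  obtain ⟨M, hM, h₁, h₂, h₃⟩ := exists_three_tight (Ω := (univ : Finset (Fin n)))
    (by rw [card_univ, Fintype.card_fin]; exact hn) (subset_univ _) (subset_univ _) (subset_univ _) U₁.2 U₂.2 U₃.2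
  exact ⟨⟨M, hM⟩, h₁, h₂, h₃⟩

end Cuts

/-! ### §3 The non-adjacent planarity step of the exact `r = 3` analysis -/

section Planar

variable {n : ℕ}

/-- **A matching tight with two cuts of non-parallel labels is labelled by their cross product.** For unit labels `u` (cuts), `v` (matchings) orthogonal
on every tight pair of a `t`-cut, and `t`-cuts `U₁, U₂` with `u_{U₁} u_{U₁}ᵀ ≠ u_{U₂} u_{U₂}ᵀ`: if `cc(U₁,M) = cc(U₂,M) = 1` then
`|p|² v_M = ⟨v_M, p⟩ p` and `⟨v_M, p⟩² = |p|² ≠ 0` for `p = u_{U₁} × u_{U₂}`. [cite: BrietDadushPokutta2014, Thm. 6 (§3)] -/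
theorem parallel_of_common_tight {t : ℕ} (u : OddSet n → Fin 3 → ℝ) (v : PMatch n → Fin 3 → ℝ) (hu : ∀ U, u U ⬝ᵥ u U = 1)
    (hv : ∀ M, v M ⬝ᵥ v M = 1) (horth : ∀ U M, U.1.card = t → cc U M = 1 → u U ⬝ᵥ v M = 0)
    {U₁ U₂ : OddSet n} (hU₁ : U₁.1.card = t) (hU₂ : U₂.1.card = t) (hne : vecMulVec (u U₁) (u U₁) ≠ vecMulVec (u U₂) (u U₂))
    {M : PMatch n} (h₁ : cc U₁ M = 1) (h₂ : cc U₂ M = 1) :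
    ((u U₁ ⨯₃ u U₂) ⬝ᵥ (u U₁ ⨯₃ u U₂)) • v M = (v M ⬝ᵥ (u U₁ ⨯₃ u U₂)) • (u U₁ ⨯₃ u U₂) ∧
      (v M ⬝ᵥ (u U₁ ⨯₃ u U₂)) ^ 2 = (u U₁ ⨯₃ u U₂) ⬝ᵥ (u U₁ ⨯₃ u U₂) ∧ (u U₁ ⨯₃ u U₂) ⬝ᵥ (u U₁ ⨯₃ u U₂) ≠ 0 := by
  have k1 : v M ⬝ᵥ u U₁ = 0 := by rw [dotProduct_comm]; exact horth U₁ M hU₁ h₁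
  have k2 : v M ⬝ᵥ u U₂ = 0 := by rw [dotProduct_comm]; exact horth U₂ M hU₂ h₂
  obtain ⟨h3, h4⟩ := smul_eq_smul_of_cross_eq_zero (cross_eq_zero_of_orth k1 k2)
  rw [hv M, one_mul] at h4
  exact ⟨h3, h4, cross_dot_cross_ne_zero (hu U₁) (hu U₂) hne⟩

/-- **PLANARITY FROM ANY INDEPENDENT PAIR (exact form).** `n` even; unit labels `u` on the cuts and `v` on the perfect matchings of `K_n`, orthogonal
on every tight pair of a `t`-cut; two `t`-cuts `U₁, U₂` with non-parallel labels. Then EVERY `t`-cut label is orthogonal to `p = u_{U₁} × u_{U₂}`: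
a perfect matching tight with `U, U₁, U₂` (§2) is labelled `∥ p` and `⊥ u_U`. This replaces step (2) of brick 76 (adjacent cuts + splitting
matchings) by a step using no adjacency. [cite: Rothvoss2017, §2 (PDF p. 6: the tight pairs `Q_1`)] [cite: BrietDadushPokutta2014, Thm. 6 (§3)] -/
theorem planar_of_independent_pair {t : ℕ} (hn : Even n) (u : OddSet n → Fin 3 → ℝ) (v : PMatch n → Fin 3 → ℝ)
    (hu : ∀ U, u U ⬝ᵥ u U = 1) (hv : ∀ M, v M ⬝ᵥ v M = 1) (horth : ∀ U M, U.1.card = t → cc U M = 1 → u U ⬝ᵥ v M = 0)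
    {U₁ U₂ : OddSet n} (hU₁ : U₁.1.card = t) (hU₂ : U₂.1.card = t) (hne : vecMulVec (u U₁) (u U₁) ≠ vecMulVec (u U₂) (u U₂))
    (U : OddSet n) (hU : U.1.card = t) : u U ⬝ᵥ (u U₁ ⨯₃ u U₂) = 0 := by
  obtain ⟨M, h0, h1, h2⟩ := exists_three_tight_cut hn U U₁ U₂
  obtain ⟨h3, h4, hpp⟩ := parallel_of_common_tight u v hu hv horth hU₁ hU₂ hne h1 h2
  have h5 := congrArg (fun w => u U ⬝ᵥ w) h3
  simp only [dotProduct_smul, smul_eq_mul] at h5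
  rw [horth U M hU h0, mul_zero] at h5
  have hvp : v M ⬝ᵥ (u U₁ ⨯₃ u U₂) ≠ 0 := fun h => hpp (by rw [← h4, h]; ring)
  exact (mul_eq_zero.1 h5.symm).resolve_left hvp

end Planar

end Summit.PneNP.PneNP.Theorems.ChebyshevTracialDesignThreeWiseTightMatching
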